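import Mathlib
import Summits.Ventures.PercRepro.TriangleCapFourBelowEleven

/-!
# PercRepro — FOUR BELOW THE DIAGONAL AT `k = 11`: THE WINDMILL BY AN EDGE COUNT (p3, gen 39; part 143)

Three triangles through `t` on `11` vertices, `m ≥ 20`, every degree `≥ 2`: the crude count needs at most TWO
transversal partners of `t` outside `W = T₁ ∪ T₂ ∪ T₃` (`|F| ≤ 4`).  With three partners `z₁, z₂, z₃` among the
four vertices outside `W`, each `z_i` has its second neighbour at the remaining vertex `y` (no neighbour in
`W ∖ {t}` or among the partners: a common neighbour with `t`), `y ≁ t`, `y` meets each triangle in at most one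
vertex (a fourth triangle otherwise), every `x ∈ W ∖ {t}` has degree `≤ 3` (its neighbours in `W` lie in its own
triangle, outside `W` only `y`), and `d(t) ≤ 9`: `2m = Σ d ≤ 9 + 18 + 6 + 6 = 39 < 40`.
**`three_triangles_stability_four_of_windmill_of_eleven`**.  Axioms: standard.
-/

namespace PercRepro

namespace TriangleCap

namespace C047

open Finset

variable {V : Type*} [Fintype V] [DecidableEq V]

/-- **AT MOST TWO TRANSVERSAL PARTNERS OF THE CENTRE ON `11` VERTICES** (in each order): `|F| ≤ 4`. -/
theorem transversal_card_le_of_windmill_of_eleven (D : SimpleGraph V) [DecidableRel D.Adj] (hK : K4mFree D)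
    (hk : Fintype.card V = 11) (hm : 6 * Fintype.card V ≤ 2 * D.edgeFinset.card + 26) (hdeg : ∀ z, 2 ≤ deg D z)
    (T₁ T₂ T₃ : Finset V) (h₁ : T₁.card = 3) (h₂ : T₂.card = 3) (h₃ : T₃.card = 3) {t : V}
    (h12 : T₁ ∩ T₂ = {t}) (h13 : T₁ ∩ T₃ = {t}) (h23 : T₂ ∩ T₃ = {t})
    (hcl₁ : ∀ x ∈ T₁, ∀ y ∈ T₁, x ≠ y → D.Adj x y) (hcl₂ : ∀ x ∈ T₂, ∀ y ∈ T₂, x ≠ y → D.Adj x y)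
    (hcl₃ : ∀ x ∈ T₃, ∀ y ∈ T₃, x ≠ y → D.Adj x y)
    (hT : ∀ x y z, D.Adj x y → D.Adj x z → D.Adj y z →
      (x ∈ T₁ ∧ y ∈ T₁) ∨ (x ∈ T₂ ∧ y ∈ T₂) ∨ (x ∈ T₃ ∧ y ∈ T₃)) :
    ((adjPairsAll D).filter (fun p => codeg D p = 0 ∧ deficit D p = 0)).card ≤ 4 := by
  have hF := transversal_subset_of_windmill D hK T₁ T₂ T₃ h₁ h₂ h₃ h12 h13 h23 hcl₁ hcl₂ hcl₃
  set W : Finset V := T₁ ∪ T₂ ∪ T₃ with hW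
  set F : Finset (V × V) := (adjPairsAll D).filter (fun p => codeg D p = 0 ∧ deficit D p = 0) with hFdef
  have hmem : ∀ {A B : Finset V}, A ∩ B = {t} → ∀ x, x ∈ A → x ∈ B → x = t := by
    intro A B h x hA hB
    have := mem_inter.mpr ⟨hA, hB⟩
    rw [h] at this
    exact mem_singleton.mp this
  have ht1 : t ∈ T₁ := (mem_inter.mp (by rw [h12]; exact mem_singleton_self t)).1
  have ht2 : t ∈ T₂ := (mem_inter.mp (by rw [h12]; exact mem_singleton_self t)).2
  have ht3 : t ∈ T₃ := (mem_inter.mp (by rw [h13]; exact mem_singleton_self t)).2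
  have htW : t ∈ W := by rw [hW, mem_union, mem_union]; exact Or.inl (Or.inl ht1)
  have hadjW : ∀ x ∈ W, x ≠ t → D.Adj t x := by
    intro x hx hxt
    rw [hW, mem_union, mem_union] at hx
    rcases hx with (hx | hx) | hx
    · exact hcl₁ t ht1 x hx (Ne.symm hxt)
    · exact hcl₂ t ht2 x hx (Ne.symm hxt)
    · exact hcl₃ t ht3 x hx (Ne.symm hxt)
  -- `|W| = 7`
  have hWc : W.card = 7 := by
    have hu : (T₁ ∪ T₂).card + (T₁ ∩ T₂).card = T₁.card + T₂.card := card_union_add_card_inter T₁ T₂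
    have hu' : (T₁ ∪ T₂ ∪ T₃).card + ((T₁ ∪ T₂) ∩ T₃).card = (T₁ ∪ T₂).card + T₃.card :=
      card_union_add_card_inter (T₁ ∪ T₂) T₃
    have hi : ((T₁ ∪ T₂) ∩ T₃).card = 1 := by
      rw [union_inter_distrib_right, h13, h23, union_self, card_singleton]
    rw [h12, card_singleton] at hu
    rw [hW]
    omega
  have hWcc : Wᶜ.card = 4 := by rw [card_compl, hWc, hk]
  -- membership in `F`
  have hadjF : ∀ z, (t, z) ∈ F → D.Adj t z ∧ codeg D (t, z) = 0 := by
    intro z hz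
    rw [hFdef, mem_filter] at hz
    unfold adjPairsAll at hz
    rw [mem_filter] at hz
    exact ⟨hz.1.2, hz.2.1⟩
  have hcodeg : ∀ z x, codeg D (t, z) = 0 → D.Adj t x → D.Adj z x → False := by
    intro z x hc h1 h2
    unfold codeg at hc
    rw [card_eq_zero, filter_eq_empty_iff] at hc
    exact hc (mem_univ x) ⟨h1, h2⟩
  -- the symmetric partners
  have hsymm : ∀ p, p ∈ F → (p.2, p.1) ∈ F := by
    intro p hp
    rw [hFdef, mem_filter] at hp ⊢
    unfold adjPairsAll at hp ⊢
    rw [mem_filter] at hp ⊢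
    refine ⟨⟨mem_univ _, hp.1.2.symm⟩, ?_, ?_⟩
    · have hc := hp.2.1
      unfold codeg at hc ⊢
      rw [card_eq_zero, filter_eq_empty_iff] at hc ⊢
      intro x hx hxx
      exact hc hx ⟨hxx.2, hxx.1⟩
    · have hd := hp.2.2
      unfold deficit at hd ⊢
      rw [card_eq_zero, filter_eq_empty_iff] at hd ⊢
      intro x hx hxx
      exact hd hx ⟨hxx.2, hxx.1⟩
  set Z₁ : Finset V := Wᶜ.filter (fun z => (t, z) ∈ F) with hZ₁
  set Z₂ : Finset V := Wᶜ.filter (fun z => (z, t) ∈ F) with hZ₂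
  have hFZ : F ⊆ ({t} ×ˢ Z₁) ∪ (Z₂ ×ˢ {t}) := by
    intro p hp
    have hp' := hF hp
    rw [mem_union, mem_product, mem_product, mem_singleton, mem_singleton] at hp'
    rw [mem_union, mem_product, mem_product, mem_singleton, mem_singleton]
    rcases hp' with ⟨h1, h2⟩ | ⟨h1, h2⟩
    · left
      refine ⟨h1, ?_⟩
      rw [hZ₁, mem_filter]
      refine ⟨h2, ?_⟩
      have : p = (t, p.2) := by rw [← h1]
      rw [← this]; exact hp
    · right
      refine ⟨?_, h2⟩
      rw [hZ₂, mem_filter]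
      refine ⟨h1, ?_⟩
      have : p = (p.1, t) := by rw [← h2]
      rw [← this]; exact hp
  have hZ21 : Z₂ ⊆ Z₁ := by
    intro z hz
    rw [hZ₂, mem_filter] at hz
    rw [hZ₁, mem_filter]
    exact ⟨hz.1, hsymm (z, t) hz.2⟩
  have hZ₁sub : Z₁ ⊆ Wᶜ := filter_subset _ _
  -- THE EDGE COUNT: at most two partners
  have hZ₁c : Z₁.card ≤ 2 := by
    by_contra hcon
    push Not at hcon
    set Y : Finset V := Wᶜ \ Z₁ with hY
    have hYc : Y.card + Z₁.card = 4 := by rw [hY, card_sdiff_add_card_eq_card hZ₁sub, hWcc]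
    have hYle : Y.card ≤ 1 := by omega
    -- (a) a partner's neighbours lie in `{t} ∪ Y`
    have hNz : ∀ z ∈ Z₁, univ.filter (fun x => D.Adj z x) ⊆ insert t Y := by
      intro z hz x hx
      rw [mem_filter] at hx
      rw [hZ₁, mem_filter] at hz
      obtain ⟨htz, hcod⟩ := hadjF z hz.2
      rw [mem_insert]
      by_cases hxt : x = t
      · exact Or.inl hxt
      right
      rw [hY, mem_sdiff]
      have hxW : x ∉ W := by
        intro hxW
        exact hcodeg z x hcod (hadjW x hxW hxt) hx.2
      refine ⟨mem_compl.mpr hxW, ?_⟩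
      intro hxZ
      rw [hZ₁, mem_filter] at hxZ
      exact hcodeg z x hcod (hadjF x hxZ.2).1 hx.2
    have hdegz : ∀ z ∈ Z₁, deg D z ≤ 1 + Y.card := by
      intro z hz
      unfold deg
      calc (univ.filter (fun x => D.Adj z x)).card ≤ (insert t Y).card := card_le_card (hNz z hz)
        _ ≤ 1 + Y.card := by rw [add_comm]; exact card_insert_le _ _
    -- a partner exists, so `|Y| = 1`, `Y = {y}`, and every partner is adjacent to `y`
    have hZne : Z₁.Nonempty := by rw [← card_pos]; omega
    obtain ⟨z₀, hz₀⟩ := hZne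
    have hY1 : Y.card = 1 := by have := hdegz z₀ hz₀; have := hdeg z₀; omega
    obtain ⟨y, hy⟩ := card_eq_one.mp hY1
    have hzy : ∀ z ∈ Z₁, D.Adj z y := by
      intro z hz
      by_contra hnadj
      have hsub : univ.filter (fun x => D.Adj z x) ⊆ {t} := by
        intro x hx
        have := hNz z hz hx
        rw [mem_insert, hy, mem_singleton] at this
        rw [mem_filter] at hx
        rcases this with h | h
        · rw [mem_singleton]; exact h
        · exact absurd (h ▸ hx.2) hnadj
      have := card_le_card hsub
      rw [card_singleton] at this
      have := hdeg z
      unfold deg at this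
      omega
    have hyW : y ∉ W := by
      have : y ∈ Y := by rw [hy]; exact mem_singleton_self y
      rw [hY, mem_sdiff, mem_compl] at this
      exact this.1
    have hyZ : y ∉ Z₁ := by
      have : y ∈ Y := by rw [hy]; exact mem_singleton_self y
      rw [hY, mem_sdiff] at this
      exact this.2
    have hty : ¬ D.Adj t y := by
      intro hty
      rw [hZ₁, mem_filter] at hz₀
      exact hcodeg z₀ y (hadjF z₀ hz₀.2).2 hty (hzy z₀ (by rw [hZ₁, mem_filter]; exact hz₀))
    -- (c) `y` meets each triangle in at most one vertex: `d(y) ≤ 6`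
    have hyT : ∀ T : Finset V, (∀ x ∈ T, ∀ x' ∈ T, x ≠ x' → D.Adj x x') → (T = T₁ ∨ T = T₂ ∨ T = T₃) →
        (T.filter (fun x => D.Adj y x)).card ≤ 1 := by
      intro T hcl hTi
      rw [card_le_one]
      intro a ha b hb
      rw [mem_filter] at ha hb
      by_contra hab
      have hadj := hcl a ha.1 b hb.1 hab
      rcases hT y a b ha.2 hb.2 hadj with h | h | h
      · exact hyW (by rw [hW, mem_union, mem_union]; exact Or.inl (Or.inl h.1))
      · exact hyW (by rw [hW, mem_union, mem_union]; exact Or.inl (Or.inr h.1))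
      · exact hyW (by rw [hW, mem_union, mem_union]; exact Or.inr h.1)
    have hdegy : deg D y ≤ 6 := by
      unfold deg
      have hsub : univ.filter (fun x => D.Adj y x) ⊆
          Z₁ ∪ (T₁.filter (fun x => D.Adj y x) ∪ T₂.filter (fun x => D.Adj y x) ∪ T₃.filter (fun x => D.Adj y x)) := by
        intro x hx
        have hx' := (mem_filter.mp hx).2
        rw [mem_union]
        by_cases hxW : x ∈ W
        · right
          rw [mem_union, mem_union]
          rw [hW, mem_union, mem_union] at hxW
          rcases hxW with (h | h) | h
          · exact Or.inl (Or.inl (mem_filter.mpr ⟨h, hx'⟩))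
          · exact Or.inl (Or.inr (mem_filter.mpr ⟨h, hx'⟩))
          · exact Or.inr (mem_filter.mpr ⟨h, hx'⟩)
        · left
          by_contra hxZ
          have hxY : x ∈ Y := by rw [hY, mem_sdiff]; exact ⟨mem_compl.mpr hxW, hxZ⟩
          rw [hy, mem_singleton] at hxY
          exact D.irrefl (hxY ▸ hx')
      calc (univ.filter (fun x => D.Adj y x)).card ≤ _ := card_le_card hsub
        _ ≤ Z₁.card + (T₁.filter (fun x => D.Adj y x) ∪ T₂.filter (fun x => D.Adj y x) ∪
            T₃.filter (fun x => D.Adj y x)).card := card_union_le _ _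
        _ ≤ Z₁.card + ((T₁.filter (fun x => D.Adj y x) ∪ T₂.filter (fun x => D.Adj y x)).card +
            (T₃.filter (fun x => D.Adj y x)).card) := by
          have := card_union_le (T₁.filter (fun x => D.Adj y x) ∪ T₂.filter (fun x => D.Adj y x))
            (T₃.filter (fun x => D.Adj y x))
          omega
        _ ≤ Z₁.card + (((T₁.filter (fun x => D.Adj y x)).card + (T₂.filter (fun x => D.Adj y x)).card) +
            (T₃.filter (fun x => D.Adj y x)).card) := by
          have := card_union_le (T₁.filter (fun x => D.Adj y x)) (T₂.filter (fun x => D.Adj y x))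
          omega
        _ ≤ 6 := by
          have e1 := hyT T₁ hcl₁ (Or.inl rfl)
          have e2 := hyT T₂ hcl₂ (Or.inr (Or.inl rfl))
          have e3 := hyT T₃ hcl₃ (Or.inr (Or.inr rfl))
          have : Z₁.card ≤ 3 := by omega
          omega
    -- (d) a vertex `x ≠ t` of `W` has degree `≤ 3`
    have hdegx : ∀ x ∈ W, x ≠ t → deg D x ≤ 3 := by
      intro x hxW hxt
      -- its neighbours outside `W` lie in `Y`
      have hout : univ.filter (fun x' => D.Adj x x') ∩ Wᶜ ⊆ Y := by
        intro x' hx'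
        rw [mem_inter, mem_filter] at hx'
        rw [hY, mem_sdiff]
        refine ⟨hx'.2, ?_⟩
        intro hx'Z
        rw [hZ₁, mem_filter] at hx'Z
        exact hcodeg x' x (hadjF x' hx'Z.2).2 (hadjW x hxW hxt) hx'.1.2.symm
      -- its neighbours inside `W` lie in its own triangle
      have hin : ∃ T : Finset V, T.card = 3 ∧ x ∈ T ∧ univ.filter (fun x' => D.Adj x x') ∩ W ⊆ T.erase x := by
        have hx3 : ∀ T A B : Finset V, T.card = 3 → x ∈ T → t ∈ T → T ∩ A = {t} → T ∩ B = {t} →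
            (∀ a ∈ T, ∀ b ∈ T, a ≠ b → D.Adj a b) → (∀ a ∈ A, ∀ b ∈ A, a ≠ b → D.Adj a b) →
            (∀ a ∈ B, ∀ b ∈ B, a ≠ b → D.Adj a b) →
            (∀ x' y' z', D.Adj x' y' → D.Adj x' z' → D.Adj y' z' →
              (x' ∈ T ∧ y' ∈ T) ∨ (x' ∈ A ∧ y' ∈ A) ∨ (x' ∈ B ∧ y' ∈ B)) →
            ∀ x' ∈ W, D.Adj x x' → x' ∈ T := by
          intro T A B _ hxT htT hTA hTB _ _ _ hT' x' hx'W hadj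
          by_cases hx't : x' = t
          · rw [hx't]; exact htT
          have h1 : D.Adj x t := (hadjW x hxW hxt).symm
          have h2 : D.Adj x' t := (hadjW x' hx'W hx't).symm
          rcases hT' x x' t hadj h1 h2 with h | h | h
          · exact h.2
          · exact absurd (hmem hTA x hxT h.1) hxt
          · exact absurd (hmem hTB x hxT h.1) hxt
        rw [hW, mem_union, mem_union] at hxW
        rcases hxW with (hx | hx) | hx
        · refine ⟨T₁, h₁, hx, ?_⟩
          intro x' hx'
          rw [mem_inter, mem_filter] at hx'
          rw [mem_erase]
          exact ⟨fun h => D.irrefl (h ▸ hx'.1.2), hx3 T₁ T₂ T₃ h₁ hx ht1 h12 h13 hcl₁ hcl₂ hcl₃ hT x' hx'.2 hx'.1.2⟩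
        · refine ⟨T₂, h₂, hx, ?_⟩
          intro x' hx'
          rw [mem_inter, mem_filter] at hx'
          rw [mem_erase]
          refine ⟨fun h => D.irrefl (h ▸ hx'.1.2), ?_⟩
          refine hx3 T₂ T₁ T₃ h₂ hx ht2 (by rw [inter_comm]; exact h12) h23 hcl₂ hcl₁ hcl₃ ?_ x' hx'.2 hx'.1.2
          intro x' y' z' a b c
          rcases hT x' y' z' a b c with h | h | h
          · exact Or.inr (Or.inl h)
          · exact Or.inl h
          · exact Or.inr (Or.inr h)
        · refine ⟨T₃, h₃, hx, ?_⟩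
          intro x' hx'
          rw [mem_inter, mem_filter] at hx'
          rw [mem_erase]
          refine ⟨fun h => D.irrefl (h ▸ hx'.1.2), ?_⟩
          refine hx3 T₃ T₁ T₂ h₃ hx ht3 (by rw [inter_comm]; exact h13) (by rw [inter_comm]; exact h23)
            hcl₃ hcl₁ hcl₂ ?_ x' hx'.2 hx'.1.2
          intro x' y' z' a b c
          rcases hT x' y' z' a b c with h | h | h
          · exact Or.inr (Or.inl h)
          · exact Or.inr (Or.inr h)
          · exact Or.inl h
      obtain ⟨T, hTc, hxT, hsubT⟩ := hin
      unfold deg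
      have hsub : univ.filter (fun x' => D.Adj x x') ⊆ T.erase x ∪ Y := by
        intro x' hx'
        rw [mem_union]
        by_cases hx'W : x' ∈ W
        · exact Or.inl (hsubT (mem_inter.mpr ⟨hx', hx'W⟩))
        · exact Or.inr (hout (mem_inter.mpr ⟨hx', mem_compl.mpr hx'W⟩))
      calc (univ.filter (fun x' => D.Adj x x')).card ≤ (T.erase x ∪ Y).card := card_le_card hsub
        _ ≤ (T.erase x).card + Y.card := card_union_le _ _
        _ = 3 := by rw [card_erase_of_mem hxT, hTc, hY1]
    -- (e) `d(t) ≤ 9`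
    have hdegt : deg D t ≤ 9 := by
      unfold deg
      have hsub : univ.filter (fun x => D.Adj t x) ⊆ (univ.erase t).erase y := by
        intro x hx
        rw [mem_filter] at hx
        rw [mem_erase, mem_erase]
        exact ⟨fun h => hty (h ▸ hx.2), fun h => D.irrefl (h ▸ hx.2), mem_univ x⟩
      calc _ ≤ ((univ.erase t).erase y).card := card_le_card hsub
        _ = 9 := by
          rw [card_erase_of_mem, card_erase_of_mem (mem_univ t), card_univ, hk]
          rw [mem_erase]
          exact ⟨fun h => hyW (h ▸ htW), mem_univ y⟩
    -- THE SUM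
    have hsum := sum_deg_eq D
    have hsplit1 : ∑ v, deg D v = ∑ v ∈ W, deg D v + ∑ v ∈ Wᶜ, deg D v := (sum_add_sum_compl W _).symm
    have hsplit2 : ∑ v ∈ W, deg D v = deg D t + ∑ v ∈ W.erase t, deg D v := (add_sum_erase W _ htW).symm
    have hsplit3 : ∑ v ∈ Wᶜ, deg D v = ∑ v ∈ Wᶜ \ Z₁, deg D v + ∑ v ∈ Z₁, deg D v := (sum_sdiff hZ₁sub).symm
    have hb1 : ∑ v ∈ W.erase t, deg D v ≤ 18 := by
      calc ∑ v ∈ W.erase t, deg D v ≤ ∑ _v ∈ W.erase t, 3 :=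
            sum_le_sum (fun v hv => hdegx v (mem_of_mem_erase hv) (ne_of_mem_erase hv))
        _ = 18 := by rw [sum_const, smul_eq_mul, card_erase_of_mem htW, hWc]
    have hb2 : ∑ v ∈ Z₁, deg D v ≤ 6 := by
      calc ∑ v ∈ Z₁, deg D v ≤ ∑ _v ∈ Z₁, 2 := sum_le_sum (fun v hv => by have := hdegz v hv; omega)
        _ ≤ 6 := by rw [sum_const, smul_eq_mul]; omega
    have hb3 : ∑ v ∈ Wᶜ \ Z₁, deg D v ≤ 6 := by
      rw [← hY, hy, sum_singleton]
      exact hdegy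
    rw [hk] at hm
    omega
  calc F.card ≤ (({t} ×ˢ Z₁) ∪ (Z₂ ×ˢ {t})).card := card_le_card hFZ
    _ ≤ ({t} ×ˢ Z₁).card + (Z₂ ×ˢ {t}).card := card_union_le _ _
    _ = Z₁.card + Z₂.card := by rw [card_product, card_product, card_singleton, one_mul, mul_one]
    _ ≤ 4 := by have := card_le_card hZ21; omega

/-- **FOUR BELOW THE DIAGONAL, THE WINDMILL ON `11` VERTICES, EVERY DEGREE `≥ 2`.** -/
theorem three_triangles_stability_four_of_windmill_of_eleven (D : SimpleGraph V) [DecidableRel D.Adj]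
    (hK : K4mFree D) (hk : Fintype.card V = 11) (hm : 6 * Fintype.card V ≤ 2 * D.edgeFinset.card + 26)
    (hdeg : ∀ z, 2 ≤ deg D z)
    (T₁ T₂ T₃ : Finset V) (h₁ : T₁.card = 3) (h₂ : T₂.card = 3) (h₃ : T₃.card = 3) {t : V}
    (h12 : T₁ ∩ T₂ = {t}) (h13 : T₁ ∩ T₃ = {t}) (h23 : T₂ ∩ T₃ = {t})
    (hcl₁ : ∀ x ∈ T₁, ∀ y ∈ T₁, x ≠ y → D.Adj x y) (hcl₂ : ∀ x ∈ T₂, ∀ y ∈ T₂, x ≠ y → D.Adj x y)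
    (hcl₃ : ∀ x ∈ T₃, ∀ y ∈ T₃, x ≠ y → D.Adj x y)
    (hT : ∀ x y z, D.Adj x y → D.Adj x z → D.Adj y z →
      (x ∈ T₁ ∧ y ∈ T₁) ∨ (x ∈ T₂ ∧ y ∈ T₂) ∨ (x ∈ T₃ ∧ y ∈ T₃)) :
    ∑ v, deg D v * deg D v + 4 * (Fintype.card V - 5) ≤ D.edgeFinset.card * Fintype.card V := by
  have hi12 : (T₁ ∩ T₂).card ≤ 1 := by rw [h12, card_singleton]
  have hi13 : (T₁ ∩ T₃).card ≤ 1 := by rw [h13, card_singleton]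
  have hi23 : (T₂ ∩ T₃).card ≤ 1 := by rw [h23, card_singleton]
  have hT3 := card_triangles3_eq_eighteen D hK T₁ T₂ T₃ h₁ h₂ h₃ hcl₁ hcl₂ hcl₃ (ne_of_inter_card_le_one h₁ hi12)
    (ne_of_inter_card_le_one h₁ hi13) (ne_of_inter_card_le_one h₂ hi23) hT
  have hFc := transversal_card_le_of_windmill_of_eleven D hK hk hm hdeg T₁ T₂ T₃ h₁ h₂ h₃ h12 h13 h23 hcl₁ hcl₂
    hcl₃ hT
  apply stability_four_of_transversal D hK (by omega) 3 hT3
  omega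

end C047

end TriangleCap

end PercRepro
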